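/-
Copyright (c) 2026. All rights reserved.
Released under Apache 2.0 license as described in the file LICENSE.
Authors: abc-iut cell, campaign-S prover seat abc-iut-S1 (wave 1, gen 7).
-/
import Literature.IUT.LogVolume.UnitLogWildDyadicEmpty
import HarnessLib

/-!
# Dyadic places with `e = 4`, `f = 1`, `ϖ⁴ ≡ 2 (mod 4)`: the `2`-adic logarithm of a unit is never a unit

Proof-only sequel (theorems, no definitions) of the cell's dyadic unit-logarithm census:
abc-iut-w5-d172's `UnitLogWildDyadic.lean` (`e = 2`, `f = 1` ⇒ empty), abc-iut-w5-d017's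
`UnitLogRamificationCriterion.lean` (`e` odd ⇒ empty; odd `p`: meets iff `p ∣ e`),
`UnitLogWildDyadicInhabited.lean` (`2 ∣ e`, `f ≥ 2` ⇒ inhabited) and `UnitLogWildDyadicEmpty.lean`
(`f = 1`, `e ≡ 2 (mod 4)` ⇒ empty; its header: «`f = 1`, `4 ∣ e` — undecided here»).  The residual class
`f = 1`, `4 ∣ e` is NOT decided by `(e, f)`: this file gives the EMPTY half at `(e, f) = (4, 1)`, the
sequel `UnitLogWildDyadicQuarticPair.lean` the INHABITED half (`ℚ₂(⁴√3)`) and the pair inside `ℚ̄₂`.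

**Theorem** (`norm_unitLog_ne_one_of_four`): if `e(K/ℚ₂) = 4`, `f(K/ℚ₂) = 1` and some `ϖ₀ ∈ K` has
`‖ϖ₀⁴ − 2‖ ≤ ‖4‖` (e.g. `ϖ₀⁴ = 2`: `K = ℚ₂(⁴√2)`; also `ℚ₂(⁴√−2)`, `ℚ₂(⁴√6)`, `ℚ₂(⁴√10)`, …), then
`‖log₂ u‖ ≠ 1` for EVERY `u : K`; so `log₂(𝒪_K^×)` misses the unit sphere
(`logUnits_inter_sphere_eq_empty_of_four`) and the second iterate of `log₂` on units has empty domain.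

PROOF (classical; Neukirch, *Algebraic Number Theory* II (5.5)), with abc-iut-w5-d017's dominant-term
toolkit `LogSeriesDominantTerm.lean` over a norm uniformizer `ϖ`: every unit is principal (`f = 1`); for
`‖1 − y‖ = ‖ϖ‖^s` the index-`m` term of `L(y)` has norm `‖ϖ‖^{s·m − 4·v₂(m)}`.  `s = 1` is the NEW case:
the indices `4, 8` tie at exponent `−4` (norm `2`), but with `x = 1 − y = a·ϖ₀`, `a` a PRINCIPAL unit
(`‖a⁴ − 1‖ ≤ ‖2‖`), one has `1 + x⁴/2 = 2 + (a⁴ − 1) + a⁴·(ϖ₀⁴ − 2)/2 ∈ 2𝒪`, so the tied pair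
`x⁴/4·(1 + x⁴/2)` has norm `≤ 2·½ = 1`; every index `∉ {2, 4, 8}` has exponent `m − 4·v₂(m) ≥ 0`
(`four_mul_padicValNat_le`); hence the index-`2` term `x²/2` (norm `‖ϖ‖⁻² = √2`) dominates strictly and
`‖L(y)‖ = √2` (`norm_logSeries_eq_of_norm_eq_unif`).  `s = 2`: the tie of `UnitLogWildDyadicEmpty`
(`norm_logSeries_lt_one_of_eq`, `< 1`); `s = 3`: unique dominant term, `‖L(y)‖ = ‖ϖ‖²`
(`norm_logSeries_eq_of_norm_eq_unif_pow_three`); `s ≥ 4`: all exponents `≥ 4`, `‖L(y)‖ ≤ ‖ϖ‖`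
(`norm_logSeries_le_of_four_le`).  The hypothesis `‖ϖ₀⁴ − 2‖ ≤ ‖4‖` is what makes `x⁴/2 ≡ 1 (mod 2)`;
for `ℚ₂(⁴√3)` it fails and the answer flips (sequel file).

Consumer: the cell's (Ind3) honest-model census ([IUTchIII] Rmk. 1.1.1 (i), record only) — dyadic
residual of the wording of record (abc-iut-w5-d017, 2026-08-26).  Nothing here is disputed mathematics;
no IUT statement is asserted; nothing bears on [IUTchIII] Cor. 3.12.
-/

noncomputable section

open Metric Set

namespace Literature.IUT.LogVolume

namespace WildDyadicQuartic

open Literature.NumberTheory.GaloisRepresentations.Ultrametric RamificationCriterion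

variable {K : Type*} [NontriviallyNormedField K] [instK : NormedAlgebra ℚ_[2] K] [IsUltrametricDist K]
  [ProperSpace K]

/-! ### §0. Arithmetic of the `2`-adic valuation of the indices -/

/-- `v₂(n) < n` for `n ≠ 0` (`v < 2^v ≤ n`). [folklore] -/
private theorem padicValNat_two_lt_self {n : ℕ} (hn : n ≠ 0) : padicValNat 2 n < n :=
  Nat.lt_two_pow_self.trans_le (Nat.le_of_dvd (Nat.pos_of_ne_zero hn) pow_padicValNat_dvd)

/-- `4v ≤ 2^v` for `v ≥ 4`. [folklore] -/
private theorem four_mul_le_two_pow {v : ℕ} (hv : 4 ≤ v) : 4 * v ≤ 2 ^ v := by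
  obtain ⟨d, rfl⟩ := Nat.exists_eq_add_of_le hv
  induction d with
  | zero => norm_num
  | succ d ih => rw [show 4 + (d + 1) = 4 + d + 1 from rfl, pow_succ]; omega

/-- `4v ≤ 3·2^v` for every `v`. [folklore] -/
private theorem four_mul_le_three_mul_two_pow (v : ℕ) : 4 * v ≤ 3 * 2 ^ v := by
  induction v with
  | zero => norm_num
  | succ v ih =>
    have h1 : 1 ≤ 2 ^ v := Nat.one_le_two_pow
    rw [pow_succ]; omega

/-- **`4·v₂(m) ≤ m` unless `m ∈ {0, 2, 4, 8}`**: for `e = 4`, `s = 1` the exponent `m − 4·v₂(m)` of the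
index-`m` term is `≥ 0` except at the indices `2` (exponent `−2`) and `4, 8` (exponent `−4`).
[cite: NeukirchANT1999, Ch. II (5.5)] -/
theorem four_mul_padicValNat_le {m : ℕ} (hm : m ≠ 0) (h2 : m ≠ 2) (h4 : m ≠ 4) (h8 : m ≠ 8) :
    4 * padicValNat 2 m ≤ m := by
  obtain ⟨v, k, hk, rfl⟩ := Nat.exists_eq_pow_mul_and_not_dvd hm 2 (by norm_num)
  rw [padicValNat_prime_pow_mul (p := 2) hk]
  have hk1 : 1 ≤ k := Nat.one_le_iff_ne_zero.mpr (by rintro rfl; exact hk (dvd_zero 2))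
  rcases Nat.lt_or_ge k 2 with hk2 | hk2
  · -- `k = 1`: `m = 2^v ∉ {2, 4, 8}`, so `v = 0` or `v ≥ 4`
    have hk' : k = 1 := by omega
    subst hk'
    rcases Nat.lt_or_ge v 4 with hv | hv
    · interval_cases v <;> simp_all
    · simpa using four_mul_le_two_pow hv
  · -- `k ≥ 3` (odd): `4v ≤ 3·2^v ≤ k·2^v`
    have hk3 : 3 ≤ k := by
      rcases Nat.lt_or_ge k 3 with h | h
      · exfalso; exact hk ⟨1, by omega⟩
      · exact h
    calc 4 * v ≤ 3 * 2 ^ v := four_mul_le_three_mul_two_pow v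
      _ ≤ 2 ^ v * k := by rw [mul_comm]; exact Nat.mul_le_mul_left _ hk3

omit instK [IsUltrametricDist K] [ProperSpace K] in
/-- Ultrametric bookkeeping: `‖a‖, ‖b‖ ≤ C ⇒ ‖a + b‖ ≤ C`. [folklore] -/
private theorem ultrametric_norm_add_le_of_le [IsUltrametricDist K] {a b : K} {C : ℝ} (ha : ‖a‖ ≤ C)
    (hb : ‖b‖ ≤ C) : ‖a + b‖ ≤ C :=
  (IsUltrametricDist.norm_add_le_max a b).trans (max_le ha hb)

/-! ### §1. `e = 4`, `f = 1`, `‖ϖ₀⁴ − 2‖ ≤ ‖4‖`: the logarithm of a unit is never a unit -/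

/-- **The new tie, `s = 1`.**  `e(K/ℚ₂) = 4`, every unit principal, `‖ϖ₀⁴ − 2‖ ≤ ‖4‖`, and
`‖1 − y‖ = ‖ϖ‖` ⇒ **`‖L(y)‖ = ‖ϖ‖⁻²`**: with `x = 1 − y = a·ϖ₀` (`a` a principal unit, so
`‖a⁴ − 1‖ ≤ ‖2‖`) one has `1 + x⁴/2 = 2 + (a⁴ − 1) + a⁴·(ϖ₀⁴ − 2)/2 ∈ 2𝒪`, so the tied indices `4, 8`
contribute `x⁴/4·(1 + x⁴/2)` of norm `≤ ‖ϖ‖⁻⁴·‖ϖ‖⁴ = 1`, every index `∉ {2, 4, 8}` has norm `≤ 1`, and the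
index-`2` term `x²/2` of norm `‖ϖ‖⁻²` dominates. [cite: NeukirchANT1999, Ch. II (5.5)] -/
theorem norm_logSeries_eq_of_norm_eq_unif {ϖ : Kˣ} (hϖ : IsUniformizer ϖ)
    (he : absRamificationIdx 2 K = 4) (hprinc : ∀ u : K, ‖u‖ = 1 → IsPrincipal u) {ϖ₀ : K}
    (hϖ₀ : ‖ϖ₀ ^ 4 - 2‖ ≤ ‖(4 : K)‖) {y : K} (hy : ‖1 - y‖ = ‖(ϖ : K)‖) :
    ‖logSeries y‖ = ‖(ϖ : K)‖ ^ (-2 : ℤ) := by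
  classical
  have hρ0 : 0 < ‖(ϖ : K)‖ := norm_units_pos ϖ
  have hρ1 : ‖(ϖ : K)‖ < 1 := hϖ.1
  have h2 : ‖(2 : K)‖ = ‖(ϖ : K)‖ ^ 4 := by
    have := norm_prime_eq_norm_pow 2 K hϖ
    rw [he] at this
    exact_mod_cast this
  have h4 : ‖(4 : K)‖ = ‖(ϖ : K)‖ ^ 8 := by
    rw [show (4 : K) = 2 * 2 by norm_num, norm_mul, h2, ← pow_add]
  have h20 : (2 : K) ≠ 0 := norm_pos_iff.mp (by rw [h2]; positivity)
  have hyP : IsPrincipal y := by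
    show ‖1 - y‖ < 1
    rw [hy]
    exact hρ1
  have hy1 : ‖1 - y‖ = ‖(ϖ : K)‖ ^ (1 : ℤ) := by rw [zpow_one]; exact hy
  set x : K := 1 - y with hx
  -- discreteness below `1`
  have hdisc : ∀ z : K, ‖z‖ < 1 → ‖z‖ ≤ ‖(ϖ : K)‖ := fun z hz ↦ by
    by_cases hz0 : z = 0
    · rw [hz0, norm_zero]; exact hρ0.le
    obtain ⟨t, ht⟩ := hϖ.2 (Units.mk0 z hz0)
    rw [Units.val_mk0] at ht
    rw [ht] at hz ⊢
    have h1t : 1 ≤ t := by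
      have := (zpow_lt_one_iff_right_of_lt_one₀ hρ0 hρ1).mp hz
      omega
    calc ‖(ϖ : K)‖ ^ t ≤ ‖(ϖ : K)‖ ^ (1 : ℤ) := zpow_le_zpow_right_of_le_one₀ hρ0 hρ1.le h1t
      _ = ‖(ϖ : K)‖ := zpow_one _
  -- `‖ϖ₀‖ = ‖ϖ‖`
  have hϖ₀4 : ‖ϖ₀ ^ 4‖ = ‖(2 : K)‖ := by
    have hlt : ‖ϖ₀ ^ 4 - 2‖ < ‖(2 : K)‖ := by
      refine hϖ₀.trans_lt ?_
      rw [h4, h2]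
      exact pow_lt_pow_right_of_lt_one₀ hρ0 hρ1 (by norm_num)
    have hmax := IsUltrametricDist.norm_add_eq_max_of_norm_ne_norm (ne_of_gt hlt)
    rwa [add_sub_cancel, max_eq_left hlt.le] at hmax
  have hϖ₀n : ‖ϖ₀‖ = ‖(ϖ : K)‖ := by
    have h' : ‖ϖ₀‖ ^ 4 = ‖(ϖ : K)‖ ^ 4 := by rw [← norm_pow, hϖ₀4, h2]
    exact (pow_left_inj₀ (norm_nonneg _) hρ0.le (by norm_num)).mp h'
  have hϖ₀0 : ϖ₀ ≠ 0 := norm_pos_iff.mp (by rw [hϖ₀n]; exact hρ0)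
  -- `a = x / ϖ₀` is a principal unit with `‖a⁴ − 1‖ ≤ ‖2‖`
  set a : K := x / ϖ₀ with ha
  have hxa : x = a * ϖ₀ := by rw [ha, div_mul_cancel₀ x hϖ₀0]
  have ha1 : ‖a‖ = 1 := by
    rw [ha, norm_div, hϖ₀n, ← hy, div_self (by rw [hy]; exact hρ0.ne')]
  have haP : ‖a - 1‖ ≤ ‖(ϖ : K)‖ := by
    rw [norm_sub_rev]
    exact hdisc _ (hprinc a ha1)
  have hρ4le : ‖(ϖ : K)‖ ^ 4 ≤ ‖(ϖ : K)‖ := pow_le_of_le_one hρ0.le hρ1.le (by norm_num)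
  have hp1 : ‖a + 1‖ ≤ ‖(ϖ : K)‖ := by
    rw [show a + 1 = (a - 1) + 2 by ring]
    exact ultrametric_norm_add_le_of_le haP (by rw [h2]; exact hρ4le)
  have hp2 : ‖a ^ 2 + 1‖ ≤ ‖(ϖ : K)‖ ^ 2 := by
    rw [show a ^ 2 + 1 = (a - 1) * (a + 1) + 2 by ring]
    refine ultrametric_norm_add_le_of_le ?_ ?_
    · rw [norm_mul, pow_two]
      exact mul_le_mul haP hp1 (norm_nonneg _) hρ0.le
    · rw [h2]
      exact pow_le_pow_of_le_one hρ0.le hρ1.le (by norm_num)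
  have ha4 : ‖a ^ 4 - 1‖ ≤ ‖(ϖ : K)‖ ^ 4 := by
    rw [show a ^ 4 - 1 = (a - 1) * (a + 1) * (a ^ 2 + 1) by ring, norm_mul, norm_mul,
      show ‖(ϖ : K)‖ ^ 4 = ‖(ϖ : K)‖ * ‖(ϖ : K)‖ * ‖(ϖ : K)‖ ^ 2 by ring]
    exact mul_le_mul (mul_le_mul haP hp1 (norm_nonneg _) hρ0.le) hp2 (norm_nonneg _)
      (mul_nonneg hρ0.le hρ0.le)
  -- the key congruence `1 + x⁴/2 ∈ 2𝒪`
  have hkey : ‖1 + x ^ 4 / 2‖ ≤ ‖(ϖ : K)‖ ^ 4 := by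
    have hdecomp : 1 + x ^ 4 / 2 = 2 + (a ^ 4 - 1) + a ^ 4 * ((ϖ₀ ^ 4 - 2) / 2) := by
      rw [hxa]
      field_simp
      ring
    rw [hdecomp]
    refine ultrametric_norm_add_le_of_le (ultrametric_norm_add_le_of_le (by rw [h2]) ha4) ?_
    rw [norm_mul, norm_pow, ha1, one_pow, one_mul, norm_div, h2, div_le_iff₀ (pow_pos hρ0 4), ← pow_add]
    exact hϖ₀.trans (by rw [h4])
  -- the series
  set f : ℕ → K := fun n ↦ -((1 - y) ^ (n + 1)) / (n + 1 : K) with hf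
  have hsum : HasSum f (logSeries y) := hasSum_logSeries 2 hyP
  have hterm : ∀ n, ‖f n‖ = ‖(ϖ : K)‖ ^ (((n + 1 : ℕ) : ℤ) - 4 * (padicValNat 2 (n + 1) : ℤ)) := by
    intro n
    rw [hf]
    dsimp only
    rw [norm_logTerm_eq_zpow 2 hϖ hy1 n, he]
    congr 1
    push_cast
    ring
  have hgen : ∀ n, n + 1 ≠ 2 → n + 1 ≠ 4 → n + 1 ≠ 8 → ‖f n‖ ≤ 1 := fun n hn2 hn4 hn8 ↦ by
    rw [hterm n]
    have h0 : (0 : ℤ) ≤ ((n + 1 : ℕ) : ℤ) - 4 * (padicValNat 2 (n + 1) : ℤ) := by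
      have h' : 4 * padicValNat 2 (n + 1) ≤ n + 1 := four_mul_padicValNat_le n.add_one_ne_zero hn2 hn4 hn8
      omega
    calc ‖(ϖ : K)‖ ^ (((n + 1 : ℕ) : ℤ) - 4 * (padicValNat 2 (n + 1) : ℤ))
        ≤ ‖(ϖ : K)‖ ^ (0 : ℤ) := zpow_le_zpow_right_of_le_one₀ hρ0 hρ1.le h0
      _ = 1 := zpow_zero _
  -- the tail (indices `≥ 9`)
  have htail := (hasSum_nat_add_iff' 8).mpr hsum
  have hT : ‖logSeries y - ∑ i ∈ Finset.range 8, f i‖ ≤ 1 := by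
    rw [← htail.tsum_eq]
    refine IsUltrametricDist.norm_tsum_le_of_forall_le_of_nonneg zero_le_one fun n ↦ ?_
    exact hgen (n + 8) (by omega) (by omega) (by omega)
  -- the dominant index `2`
  have hv2 : padicValNat 2 2 = 1 := by simp
  have hf1 : ‖f 1‖ = ‖(ϖ : K)‖ ^ (-2 : ℤ) := by
    rw [hterm 1]
    norm_num [hv2]
  -- the tied indices `4, 8`
  have hv4 : padicValNat 2 4 = 2 := by
    rw [show (4 : ℕ) = 2 ^ 2 by norm_num, padicValNat.prime_pow]
  have hf3 : f 3 = -(x ^ 4 / 4) := by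
    rw [hf]
    dsimp only
    rw [hx]
    norm_num [neg_div]
  have hf7 : f 7 = -(x ^ 8 / 8) := by
    rw [hf]
    dsimp only
    rw [hx]
    norm_num [neg_div]
  have hx4 : ‖x ^ 4 / 4‖ = ‖(ϖ : K)‖ ^ (-4 : ℤ) := by
    rw [← norm_neg, ← hf3, hterm 3]
    norm_num [hv4]
  have hpair_eq : f 3 + f 7 = -(x ^ 4 / 4 * (1 + x ^ 4 / 2)) := by
    rw [hf3, hf7]
    have h40 : (4 : K) ≠ 0 := by
      rw [show (4 : K) = 2 * 2 by norm_num]; exact mul_ne_zero h20 h20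
    have h80 : (8 : K) ≠ 0 := by
      rw [show (8 : K) = 2 * 2 * 2 by norm_num]; exact mul_ne_zero (mul_ne_zero h20 h20) h20
    field_simp
    ring
  have hpair : ‖f 3 + f 7‖ ≤ 1 := by
    rw [hpair_eq, norm_neg, norm_mul, hx4]
    calc ‖(ϖ : K)‖ ^ (-4 : ℤ) * ‖1 + x ^ 4 / 2‖
        ≤ ‖(ϖ : K)‖ ^ (-4 : ℤ) * ‖(ϖ : K)‖ ^ 4 := by gcongr
      _ = 1 := by rw [← zpow_natCast, ← zpow_add₀ hρ0.ne']; norm_num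
  -- the remaining small indices `1, 3, 5, 6, 7`
  have h0' : ‖f 0‖ ≤ 1 := hgen 0 (by omega) (by omega) (by omega)
  have h2' : ‖f 2‖ ≤ 1 := hgen 2 (by omega) (by omega) (by omega)
  have h4' : ‖f 4‖ ≤ 1 := hgen 4 (by omega) (by omega) (by omega)
  have h5' : ‖f 5‖ ≤ 1 := hgen 5 (by omega) (by omega) (by omega)
  have h6' : ‖f 6‖ ≤ 1 := hgen 6 (by omega) (by omega) (by omega)
  have hR : ‖(f 0 + f 2 + (f 3 + f 7) + f 4 + f 5 + f 6)
      + (logSeries y - ∑ i ∈ Finset.range 8, f i)‖ ≤ 1 :=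
    ultrametric_norm_add_le_of_le (ultrametric_norm_add_le_of_le (ultrametric_norm_add_le_of_le (ultrametric_norm_add_le_of_le
      (ultrametric_norm_add_le_of_le (ultrametric_norm_add_le_of_le h0' h2') hpair) h4') h5') h6') hT
  have hsplit : logSeries y = f 1 + ((f 0 + f 2 + (f 3 + f 7) + f 4 + f 5 + f 6)
      + (logSeries y - ∑ i ∈ Finset.range 8, f i)) := by
    simp only [Finset.sum_range_succ, Finset.sum_range_zero]
    ring
  have hgt : 1 < ‖(ϖ : K)‖ ^ (-2 : ℤ) :=
    (one_lt_zpow_iff_right_of_lt_one₀ hρ0 hρ1).mpr (by norm_num)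
  have hlt : ‖(f 0 + f 2 + (f 3 + f 7) + f 4 + f 5 + f 6)
      + (logSeries y - ∑ i ∈ Finset.range 8, f i)‖ < ‖f 1‖ := by
    rw [hf1]
    exact hR.trans_lt hgt
  rw [hsplit, IsUltrametricDist.norm_add_eq_max_of_norm_ne_norm (ne_of_gt hlt), max_eq_left hlt.le, hf1]

/-- **`s = 3`: a unique dominant term.**  `e = 4`, `‖1 − y‖ = ‖ϖ‖³` ⇒ `‖L(y)‖ = ‖ϖ‖²` (the exponents
`3m − 4·v₂(m)` are `3, 2, 9, 4, …`, minimal only at `m = 2`). [cite: NeukirchANT1999, Ch. II (5.5)] -/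
theorem norm_logSeries_eq_of_norm_eq_unif_pow_three {ϖ : Kˣ} (hϖ : IsUniformizer ϖ)
    (he : absRamificationIdx 2 K = 4) {y : K} (hy : ‖1 - y‖ = ‖(ϖ : K)‖ ^ (3 : ℤ)) :
    ‖logSeries y‖ = ‖(ϖ : K)‖ ^ (2 : ℤ) := by
  classical
  have hρ0 : 0 < ‖(ϖ : K)‖ := norm_units_pos ϖ
  have hyP : IsPrincipal y := by
    show ‖1 - y‖ < 1
    rw [hy]
    exact zpow_lt_one₀ hρ0 hϖ.1 (by norm_num)
  have hv2 : padicValNat 2 2 = 1 := by simp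
  have hv4 : padicValNat 2 4 = 2 := by
    rw [show (4 : ℕ) = 2 ^ 2 by norm_num, padicValNat.prime_pow]
  have hv8 : padicValNat 2 8 = 3 := by
    rw [show (8 : ℕ) = 2 ^ 3 by norm_num, padicValNat.prime_pow]
  have h₀ : (3 : ℤ) * ((1 + 1 : ℕ) : ℤ) - (absRamificationIdx 2 K : ℤ) * (padicValNat 2 (1 + 1) : ℤ)
      = 2 := by
    rw [he]
    norm_num [hv2]
  have hdom : ∀ n : ℕ, n ≠ 1 →
      (2 : ℤ) + 1 ≤ 3 * ((n + 1 : ℕ) : ℤ) - (absRamificationIdx 2 K : ℤ) * (padicValNat 2 (n + 1) : ℤ) := by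
    intro n hn
    rw [he]
    by_cases hn0 : n = 0
    · subst hn0; norm_num
    by_cases hn3 : n = 3
    · subst hn3; norm_num [hv4]
    by_cases hn7 : n = 7
    · subst hn7; norm_num [hv8]
    have h : 4 * padicValNat 2 (n + 1) ≤ n + 1 :=
      four_mul_padicValNat_le n.add_one_ne_zero (by omega) (by omega) (by omega)
    have hcast : ((n + 1 : ℕ) : ℤ) = (n : ℤ) + 1 := by push_cast; ring
    rw [hcast]
    simp only [Nat.cast_ofNat]
    omega
  exact norm_logSeries_eq_zpow_of_dominant 2 hϖ hyP hy 1 h₀ hdom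

/-- **`s ≥ 4`: every term is small.**  `e = 4`, `‖1 − y‖ = ‖ϖ‖^s`, `s ≥ 4` ⇒ `‖L(y)‖ ≤ ‖ϖ‖` (all
exponents `s·m − 4·v₂(m) ≥ 4(m − v₂(m)) ≥ 4`). [cite: NeukirchANT1999, Ch. II (5.5)] -/
theorem norm_logSeries_le_of_four_le {ϖ : Kˣ} (hϖ : IsUniformizer ϖ)
    (he : absRamificationIdx 2 K = 4) {y : K} {s : ℤ} (hs : 4 ≤ s)
    (hy : ‖1 - y‖ = ‖(ϖ : K)‖ ^ s) : ‖logSeries y‖ ≤ ‖(ϖ : K)‖ := by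
  refine norm_logSeries_le_norm_unif 2 hϖ hy fun n ↦ ?_
  rw [he]
  have hv : padicValNat 2 (n + 1) < n + 1 := padicValNat_two_lt_self n.add_one_ne_zero
  have hv' : (padicValNat 2 (n + 1) : ℤ) ≤ n := by omega
  have hcast : ((n + 1 : ℕ) : ℤ) = (n : ℤ) + 1 := by push_cast; ring
  rw [hcast]
  simp only [Nat.cast_ofNat]
  have hn0 : (0 : ℤ) ≤ (n : ℤ) := by positivity
  nlinarith [mul_nonneg (sub_nonneg.mpr hs) (show (0 : ℤ) ≤ (n : ℤ) + 1 by positivity)]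

/-- **`e(K/ℚ₂) = 4`, every unit principal, `‖ϖ₀⁴ − 2‖ ≤ ‖4‖` ⇒ `‖L(y)‖ ≠ 1` for every principal `y`.**
With `‖1 − y‖ = ‖ϖ‖^s`: `s = 1` (`√2`), `s = 2` (`< 1`, the tie of `UnitLogWildDyadicEmpty`), `s = 3`
(`‖ϖ‖²`), `s ≥ 4` (`≤ ‖ϖ‖`). [cite: NeukirchANT1999, Ch. II (5.5)] -/
theorem norm_logSeries_ne_one_of_four (he : absRamificationIdx 2 K = 4)
    (hprinc : ∀ u : K, ‖u‖ = 1 → IsPrincipal u) {ϖ₀ : K} (hϖ₀ : ‖ϖ₀ ^ 4 - 2‖ ≤ ‖(4 : K)‖)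
    {y : K} (hyP : IsPrincipal y) : ‖logSeries y‖ ≠ 1 := by
  classical
  obtain ⟨ϖ, hϖ⟩ := exists_isUniformizer (F := K)
  have hρ0 : 0 < ‖(ϖ : K)‖ := norm_units_pos ϖ
  have hρ1 : ‖(ϖ : K)‖ < 1 := hϖ.1
  by_cases hx : 1 - y = 0
  · have : y = 1 := (sub_eq_zero.mp hx).symm
    rw [this, logSeries_one, norm_zero]
    exact zero_ne_one
  obtain ⟨s, hs⟩ := hϖ.2 (Units.mk0 (1 - y) hx)
  rw [Units.val_mk0] at hs
  have hs1 : 1 ≤ s := by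
    have h1 : ‖(ϖ : K)‖ ^ s < 1 := hs ▸ hyP
    have := (zpow_lt_one_iff_right_of_lt_one₀ hρ0 hρ1).mp h1
    omega
  rcases (show s = 1 ∨ s = 2 ∨ s = 3 ∨ 4 ≤ s by omega) with h | h | h | h
  · subst h
    rw [zpow_one] at hs
    rw [norm_logSeries_eq_of_norm_eq_unif hϖ he hprinc hϖ₀ hs]
    exact ne_of_gt ((one_lt_zpow_iff_right_of_lt_one₀ hρ0 hρ1).mpr (by norm_num))
  · subst h
    have hs' : ‖1 - y‖ = ‖(ϖ : K)‖ ^ ((2 : ℕ) : ℤ) := by rw [hs]; norm_cast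
    exact ne_of_lt (norm_logSeries_lt_one_of_eq hϖ (k := 2) (by rw [he]) hprinc hs')
  · subst h
    rw [norm_logSeries_eq_of_norm_eq_unif_pow_three hϖ he hs]
    exact ne_of_lt (zpow_lt_one₀ hρ0 hρ1 (by norm_num))
  · exact ne_of_lt ((norm_logSeries_le_of_four_le hϖ he h hs).trans_lt hρ1)

/-- **`e(K/ℚ₂) = 4`, `f(K/ℚ₂) = 1`, `‖ϖ₀⁴ − 2‖ ≤ ‖4‖` for some `ϖ₀ ∈ K` ⇒ `‖log₂ u‖ ≠ 1` for EVERY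
`u : K`** (`f = 1`: every unit is principal, so `log₂ u = L(u)`).  E.g. `K = ℚ₂(⁴√2)`.
[cite: NeukirchANT1999, Ch. II (5.5)] -/
theorem norm_unitLog_ne_one_of_four (he : absRamificationIdx 2 K = 4) (hf : residueDegree 2 K = 1)
    {ϖ₀ : K} (hϖ₀ : ‖ϖ₀ ^ 4 - 2‖ ≤ ‖(4 : K)‖) (u : K) : ‖unitLog u‖ ≠ 1 := by
  by_cases hu : ‖u‖ = 1
  · have hP : IsPrincipal u := WildDyadic.isPrincipal_of_residueDegree_eq_one hf hu
    rw [unitLog_of_isPrincipal 2 hP]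
    exact norm_logSeries_ne_one_of_four he
      (fun v hv ↦ WildDyadic.isPrincipal_of_residueDegree_eq_one hf hv) hϖ₀ hP
  · rw [unitLog_of_norm_ne_one hu, norm_zero]
    exact zero_ne_one

/-- **… so `log₂(𝒪_K^×)` MISSES the unit sphere** for such `K` (`(e, f) = (4, 1)`, `‖ϖ₀⁴ − 2‖ ≤ ‖4‖`).
[cite: NeukirchANT1999, Ch. II (5.5)] -/
theorem logUnits_inter_sphere_eq_empty_of_four (he : absRamificationIdx 2 K = 4)
    (hf : residueDegree 2 K = 1) {ϖ₀ : K} (hϖ₀ : ‖ϖ₀ ^ 4 - 2‖ ≤ ‖(4 : K)‖) :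
    logUnits K ∩ sphere 0 1 = ∅ := by
  ext z
  simp only [mem_inter_iff, mem_sphere_zero_iff_norm, mem_empty_iff_false, iff_false, not_and]
  rintro ⟨u, -, rfl⟩
  exact norm_unitLog_ne_one_of_four he hf hϖ₀ u

/-- … and the "second iterate" of `log₂` on units has EMPTY domain there.
[cite: NeukirchANT1999, Ch. II (5.5)] -/
theorem unitLog_image_logUnits_inter_sphere_eq_empty_of_four (he : absRamificationIdx 2 K = 4)
    (hf : residueDegree 2 K = 1) {ϖ₀ : K} (hϖ₀ : ‖ϖ₀ ^ 4 - 2‖ ≤ ‖(4 : K)‖) :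
    unitLog '' (logUnits K ∩ sphere 0 1) = ∅ := by
  rw [logUnits_inter_sphere_eq_empty_of_four he hf hϖ₀, image_empty]

end WildDyadicQuartic

end Literature.IUT.LogVolume

end
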